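import Summits.QuantumFields.YangMills.Theorems.BalabanUVNodesN27AtAdmReadingOfRecord13CoPH
import Summits.QuantumFields.YangMills.Theorems.BalabanUVNodesN15AtReadingOfRecord13CoPHC2Bg
import Summits.QuantumFields.YangMills.Theorems.BalabanUVNodesN16AtRRec13CoPHLeafSlotAT

/-!
# BalabanUVNodes ∕ N27 = binder B5 AT THE RECORD — XLIᶜᵒᵖᴴ AT THE ADMISSIBLE `CoPH` READING OF RECORD WITH N15 CARRIED BY dag-n15-c's PRIMITIVE-CARRIER FAMILY WITH THE
# U-SEEING (2.156) UNIT LAYER (`c2BgObjects`: the OPERATOR layer AND the UNIT layer read the background; site = the genuine `U ≡ 1` scalar-sector kernel) AND N16 IN THE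
# LIVE AT-KEYED LEAF FORM (trigger (t2) of this seat: dag-n15-a g16 U-E `…N15AtReadingOfRecord13CoPHC2Bg`, «producer faces for n27-c's `h15`»; sibling of (F)
# `…N27AtAdmReadingOfRecord13CoPHGenuineN15` p559522∕p563426 whose §1∕§2 read the window-free `fullGCovObjects` (part 77) and §3 the by-parts family `byPartsObjects` (part 80,
# operator layer «+» LIVE) — (F) is at 306 of 400 lines, hence a NEW leaf): `h15` ⟸ U-E `s_N15_readingOfRecord₁₃CoPH(On)_of_c2Bg_family` (hypothesis `hne2` VERBATIM: the residual
# layer read as `c2BgObjects 3 F.hL b a_S α β c₃₅ p`, plain `b, a_S, c₃₅ > 0`), `h16` AT-keyed ⟸ dag-n16-e 39ᴴ, every other binder = (F) §3's, byte-for-byte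
# (cell `pub-ymgap`, HUMAN RULING D-0062 Track A, R134 seat `pub-ymgap-dag-n27-c` (s2) gen 10; K3⁷ `SpineGivenEndpointR13SepCoPH` = stmt-QuantumFields-20544, `--kind proof --supports
# 20544 --as helper`; COUNT-NEUTRAL; THEOREMS ONLY, 0 `def`, 0 `sorry`; `N`-generic, regime-generic, NO Theses import — the item-facing face is ONE application of leaf A §4 at
# `Rg := Node00.unityNondeg₁₃H 2`, `N = 2` at the call site)

WHAT IS KERNEL-CHECKED ([bookkeeping]; each theorem ONE application of XLᶜᵒᵖᴴ `spine_rec13CCoPH(On)_at_readingOfRecord₁₃CoPH` at the admissible reading with the producers'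
theorems in the N15 ∕ N16 slots and dag-n22-e 8a″ eliminating N22 given N18):
* §1 `spine_rec13CCoPH_at_readingAdm₁₃CoPH_of_c2Bg_family` — CANONICAL HOME: N18 in stub form, N22 ⟸ N18 (analytic currency, (J), (A), eleven numerals VERBATIM), NE1′ at
  `h.params`, (D4), spine side as XLIᶜᵒᵖᴴ §1; N15 ⟸ the reading equation `hne2` (U-E `s_N15_readingOfRecord₁₃CoPH_of_c2Bg_family`); N16 ⟸ `InEndRegime ∧ LeafSlotAT` once per family.
* §2 `spine_rec13CCoPHOn_at_readingAdm₁₃CoPH_of_c2Bg_family` — REGIME HOME, any `Rg`: N18 in closed form at θ, N22 ⟸ N18 (STRIP currency, (J), twelve numerals, STRIP-(1.18)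
  VERBATIM), the rest as XLIᶜᵒᵖᴴ §2; N15 ⟸ U-E `s_N15_readingOfRecord₁₃CoPHOn_of_c2Bg_family … hne2 Rg`; at `Rg := Node00.unityNondeg₁₃H N` RR-2's CN class.

HONEST FRAMING.  COMPOSITE-node bookkeeping BY NAME: the N15 slot is inhabited by dag-n15-a∕dag-n15-c's MODEL-LEVEL theorems (by-parts species with abelianised first-order
coefficients and a block-averaged coarse partner, abelianised `Q`, linearised + symmetrised dressing — their U-D∕U-E docstrings; NOT [B9] Thm 3.15 at general `U`); the reading
equation `hne2` (Node 00's pin of `ne2`) is the residual hypothesis and is NOT claimed; `InEndRegime ∧ LeafSlotAT` is asserted for no family; every other estimate ∕ clause is a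
DISPLAYED hypothesis (0∕1 at the ₁₃ record today); nothing of Bałaban's asserted or instantiated; no `Provisos₁₃CoPH` inhabitant claimed (K0⁷ open); N15 ∕ N16 ∕ N18 ∕ N22 ∕ N27 NOT
discharged; K3⁷ NOT claimed; counts UNMOVED (typed 28∕28 · discharged 5∕27, A 5∕28); one finite four-torus programme at fixed `ε` — NOT ℝ⁴, NOT infinite volume, NOT OS, NOT a
mass gap, NOT Clay.  No decl below carries a cite tag.
-/

namespace Summit.QuantumFields.YangMills.Theorems.BalabanUVNodesN27SpineRecord

open Set Metric
open scoped Matrix.Norms.L2Operator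

open Literature.MathematicalPhysics.QuantumFieldTheory.Balaban1983to89
open Literature.MathematicalPhysics.QuantumFieldTheory.Balaban1983to89.T4Continuum
open Literature.MathematicalPhysics.QuantumFieldTheory.Balaban1983to89.T4OutputRate (Carriers Functional NE5 DecayBound Window)
open Literature.MathematicalPhysics.QuantumFieldTheory.Balaban1983to89.TreeLengthTorus (TDom tsys torusTreeLen)
open Summit.QuantumFields.BalabanUV.T4Continuum.Spine.NE5
open YMDAG.N18.HLayer
open YMDAG.N18.W1Reading (n18At_u3OfRecord₁₃_readingAdm_iff)
open T4ContinuumYM4Torus (ForSmallCouplings)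
open Summit.QuantumFields.BalabanUV.T4Continuum.Spine
open YMDAG.UVSplit
open Node00 (Stage13HParams datumOfRecord₁₃CoPH IsRecordOfRecord₁₃CCoPH IsDatumOfRecord₁₃CCoPH NE3Letters₁₁ NE2Objects₁₁ ne3ConstLayerOfRecord₁₁ MatA ιSU prependCoupling)
open Node00.Sect2 (domCount domSys CPair ofBackgroundC)
open Node00.W1 (ReadingData LevelPairing LetterInputs ClusterTower pairOfRecord functionalC termC box SpRestr AdmBg)
open YMDAG.N22 (s_N22_readingOfRecord₁₃CoPH_ofRecordAdm_of_s_N18_analytic s_N22_readingOfRecord₁₃CoPHOn_ofRecordAdm_of_s_N18_stripBound)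
open Summit.QuantumFields.YangMills.BalabanUVNodes.N16Regime (InEndRegime)
open Summit.QuantumFields.YangMills.BalabanUVNodes.N15.AtKeyedHome (neZero_blockFactor)
open Summit.QuantumFields.YangMills.BalabanUVNodes.N16LeafSlotAllTorus (LeafSlotAT)
open Summit.QuantumFields.YangMills.BalabanUVNodes.N16AtRRec13CoPHLeafSlotAT (s_N16_rRec₁₃CoPH_of_constLayer_leafSlotAT s_N16_rRec₁₃CoPHOn_ofRecord_of_leafSlotAT)
open Summit.QuantumFields.YangMills.BalabanUVNodes.N15.UnitLayerBg (c2BgObjects)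
open Summit.QuantumFields.YangMills.BalabanUVNodes.N15.AtReadingOfRecord13CoPH (s_N15_readingOfRecord₁₃CoPH_of_c2Bg_family s_N15_readingOfRecord₁₃CoPHOn_of_c2Bg_family)

variable {N : ℕ} [NeZero N] (cr : SpineReading₁₃CoPH N)
  (S : (F : T4Family) → (θ : Stage13HParams F N) → (k : ℕ) → ClusterTower (F.P k) (MatA N) θ.τ9.M)
  (sp : (F : T4Family) → (θ : Stage13HParams F N) → (k j : ℕ) → (domSys (F.P k) θ.τ9.M j).Dom → Set (CPair (F.P k) (MatA N)))
  (gauge : (F : T4Family) → (θ : Stage13HParams F N) → (k : ℕ) → GaugeField (F.P k) 0 (Node00.SU N) → GaugeField (F.P k) 0 (Node00.SU N) → ℝ)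
  (hg : ∀ (F : T4Family) (θ : Stage13HParams F N) (k : ℕ) (U U' : GaugeField (F.P k) 0 (Node00.SU N)), 0 ≤ gauge F θ k U U')
  (T₀ : (F : T4Family) → (θ : Stage13HParams F N) → (k : ℕ) → GaugeField (F.P (k + 1)) 0 (Node00.SU N) → GaugeField (F.P k) 0 (Node00.SU N))
  (hT₀ : ∀ (F : T4Family) (θ : Stage13HParams F N) (k : ℕ) (U : GaugeField (F.P (k + 1)) 0 (Node00.SU N)),
    (∀ (j : ℕ) (Y : (domSys (F.P (k + 1)) θ.τ9.M j).Dom), ofBackgroundC (ιSU N) U ∈ sp F θ (k + 1) j Y) →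
      ∀ (j : ℕ) (X : (domSys (F.P k) θ.τ9.M j).Dom), ofBackgroundC (ιSU N) (T₀ F θ k U) ∈ sp F θ k j X)
  (li : (F : T4Family) → Stage13HParams F N → LetterInputs) (ℓ₃ : T4Family → NE3Letters₁₁)
  (ne2 : (F : T4Family) → Stage13HParams F N → (ℕ → ℝ) → List (ULoop F) → ℕ → NE2Objects₁₁)
  (ne1 : (F : T4Family) → Stage13HParams F N → (ℕ → ℝ) → List (ULoop F) → NE1pCarriers)

/-! ## §1 The canonical home of the admissible reading of record — N15 carried by the primitive-carrier family with the U-seeing unit layer, N16 AT-keyed -/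

section Canonical

/-- ★ **N27 = B5 AT THE STAGE-13 `CoPH` RECORD AT THE ADMISSIBLE READING WITH N15 CARRIED BY THE PRIMITIVE-CARRIER FAMILY (OPERATOR AND UNIT LAYERS READ THE BACKGROUND) AND
N16 AT-KEYED** — (F) §3 `spine_rec13CCoPH_at_readingAdm₁₃CoPH_of_byParts_family` with the residual layer read as dag-n15-a's `c2BgObjects 3 F.hL b a_S α β c₃₅ p` (`b, a_S, c₃₅ > 0`;
U-E `s_N15_readingOfRecord₁₃CoPH_of_c2Bg_family`, hypothesis `hne2` VERBATIM — dag-n15-a∕dag-n15-c's MODEL-level theorems: kernel `tgCovBg` READS `U`, certificate `tgCovBg_one`);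
every other binder = (F) §3's (XLIᶜᵒᵖᴴ §1: N18 in stub form, N22 ⟸ N18 by 8a″ analytic, N17 eliminated).  The reading equation is the residual hypothesis.  Every other displayed
hypothesis 0∕1 today. [bookkeeping] -/
theorem spine_rec13CCoPH_at_readingAdm₁₃CoPH_of_c2Bg_family {b aS : ℝ} (hb : 0 < b) (haS : 0 < aS) {c35 : ℝ} (hc35 : 0 < c35) (α β : Fin 4) (p : ℝ)
    (h14 : ∀ (F : T4Family) (D : Datum F N) (h : IsDatumOfRecord₁₃CCoPH F N D) (g₀ : ℕ → ℝ) (os : List (ULoop F)), N14At (ne1 F h.params g₀ os))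
    (h16 : ∀ (F : T4Family), (∃ D : Datum F N, IsDatumOfRecord₁₃CCoPH F N D) →
      InEndRegime (ne3OfRecord₁₁ F (ne3ConstLayerOfRecord₁₁ F N (ℓ₃ F))) ∧ LeafSlotAT (ne3OfRecord₁₁ F (ne3ConstLayerOfRecord₁₁ F N (ℓ₃ F))))
    (h18 : S_N18 (RRec₁₃CoPH (readingOfRecord₁₃CoPH
      (fun F θ => ReadingData.ofRecordAdm F θ.τ9.M N (S F θ) (sp F θ) (gauge F θ) (hg F θ) (T₀ F θ) (hT₀ F θ) (li F θ)) ℓ₃ ne2 ne1)))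
    -- N22 ⟸ N18 (dag-n22-e module 8a″, analytic sup-letter currency): (J), (A) over ADMISSIBLE run-A fields, eleven numerals — verbatim
    (hjunk : ∀ (F : T4Family) (θ : Stage13HParams F N), θ.Provisos₁₃CoPH F N → θ.Admissible F N →
      ∀ (k : ℕ) (X : Node00.W1.Dom (F.P k) θ.τ9.M), k < X.1 → ∀ (g : ℕ → ℝ) (φ : CPair (F.P k) (MatA N)), functionalC (S F θ k) g φ X = 0)
    (hA : ∀ (F : T4Family) (θ : Stage13HParams F N), θ.Provisos₁₃CoPH F N → θ.Admissible F N → ∀ (k : ℕ),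
      ∀ g ∈ Window θ.γ, ∀ (U : AdmBg F θ.τ9.M N (sp F θ) k) (X : Node00.W1.Dom (F.P k) θ.τ9.M) (i : ℕ), i < X.1 →
        ∃ (Fz : ℂ → ℂ) (Dset : Set ℂ), DifferentiableOn ℂ Fz Dset ∧
          (∀ z ∈ Dset, ‖Fz z‖ ≤ (li F θ).A * (li F θ).μ ^ (X.1 - 1 - i) * Real.exp (-((li F θ).κ * (domSys (F.P k) θ.τ9.M X.1).dj X.2))) ∧
          (∀ t ∈ Ioc (0 : ℝ) θ.γ, closedBall (t : ℂ) (li F θ).r ⊆ Dset) ∧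
          (∀ t ∈ Ioc (0 : ℝ) θ.γ, Fz t = ((functionalC (S F θ k) (Function.update g i t) (ofBackgroundC (ιSU N) U.1) X).re : ℂ)))
    (hnum : ∀ (F : T4Family) (θ : Stage13HParams F N), θ.Provisos₁₃CoPH F N → θ.Admissible F N →
      0 < (li F θ).C₀ ∧ 0 < (li F θ).θ₅ ∧ (li F θ).θ₅ < 1 ∧ 0 ≤ (li F θ).C₅ ∧ 2 * (li F θ).C₅ / (1 - (li F θ).θ₅) ≤ (li F θ).C₀ ∧ 0 < (li F θ).A ∧
        (li F θ).θ₅ ≤ (li F θ).μ ∧ (li F θ).C₀ ≤ 2 * (li F θ).A ∧ 0 < (li F θ).r ∧ 0 < (li F θ).s ∧ (li F θ).s < 1)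
    (hD4 : ∀ (F : T4Family) (D : Datum F N) (h : IsDatumOfRecord₁₃CCoPH F N D) (k : ℕ), ReadOutAt D (u3OfRecord₁₃ h.params.toStage13Params
      ((ReadingData.ofRecordAdm F h.params.τ9.M N (S F h.params) (sp F h.params) (gauge F h.params) (hg F h.params) (T₀ F h.params) (hT₀ F h.params)
        (li F h.params)).u3Objects h.params.γ) k))
    (hx' : S_N27x (fun F D w => IsRecordOfRecord₁₃CCoPH F N D w) (SRec₁₃CoPH cr)) (h20 : S_N20 (SRec₁₃CoPH cr)) (h21 : S_N21 (SRec₁₃CoPH cr))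
    (h19 : ∀ (F : T4Family) (θ : Stage13HParams F N) (hP : θ.Provisos₁₃CoPH F N), θ.Admissible F N → ∀ (g₀ : ℕ → ℝ) (os : List (ULoop F))
      (h : IsDatumOfRecord₁₃CCoPH F N (datumOfRecord₁₃CoPH F N θ hP)) (k : ℕ),
      RatesAt (datumOfRecord₁₃CoPH F N θ hP) (rateCarriersOfRecord₁₃CoPH (readingOfRecord₁₃CoPH
        (fun F θ => ReadingData.ofRecordAdm F θ.τ9.M N (S F θ) (sp F θ) (gauge F θ) (hg F θ) (T₀ F θ) (hT₀ F θ) (li F θ)) ℓ₃ ne2 ne1)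
          F h.params h.provisos g₀ os k) → letI := (cr F θ hP g₀ os).dec
        ∃ δ : ℕ → ℝ, NE7.Core (cr F θ hP g₀ os).l₀ (cr F θ hP g₀ os).vol (cr F θ hP g₀ os).T (cr F θ hP g₀ os).Bad
          (fun K t τ => (cr F θ hP g₀ os).A K t τ - (cr F θ hP g₀ os).shA K t τ) (fun K t τ => (cr F θ hP g₀ os).B K t τ - (cr F θ hP g₀ os).shB K t τ) δ ∧
          Summable δ)
    (hne2 : ∀ (F : T4Family) (θ : Stage13HParams F N), θ.Provisos₁₃CoPH F N → θ.Admissible F N → ∀ (g₀ : ℕ → ℝ) (os : List (ULoop F)) (k : ℕ),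
      ne2 F θ g₀ os k = haveI := neZero_blockFactor F; c2BgObjects 3 F.hL b aS α β c35 p) :
    Spine (N := N) fun F D w => IsRecordOfRecord₁₃CCoPH F N D w :=
  spine_rec13CCoPH_at_readingOfRecord₁₃CoPH cr _ ℓ₃ ne2 ne1 ((s_N14_readingOfRecord₁₃CoPH_iff _ ℓ₃ ne2 ne1).mpr h14)
    (s_N15_readingOfRecord₁₃CoPH_of_c2Bg_family _ ℓ₃ ne2 ne1 hb haS hc35 α β p hne2)
    (s_N16_rRec₁₃CoPH_of_constLayer_leafSlotAT (readingOfRecord₁₃CoPH _ ℓ₃ ne2 ne1) (fun F => ne3ConstLayerOfRecord₁₁ F N (ℓ₃ F)) (fun _ _ _ _ _ _ => rfl) h16) h18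
    (s_N22_readingOfRecord₁₃CoPH_ofRecordAdm_of_s_N18_analytic S sp gauge hg T₀ hT₀ li ℓ₃ ne2 ne1 h18 hjunk hA hnum)
    ((s_D4_readingOfRecord₁₃CoPH_iff _ ℓ₃ ne2 ne1).mpr hD4) hx' h20 h21 h19

end Canonical

/-! ## §2 The regime-restricted home of the admissible reading of record, any regime `Rg` — the same N15 ∕ N16 slots -/

section Regime

/-- ★ **N27 = B5 AT THE REGIME RECORD CLASS AT THE ADMISSIBLE READING WITH N15 CARRIED BY THE PRIMITIVE-CARRIER FAMILY AND N16 AT-KEYED** — (F) §3's regime twin with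
`h15` ⟸ U-E `s_N15_readingOfRecord₁₃CoPHOn_of_c2Bg_family … hne2 Rg` (XLIᶜᵒᵖᴴ §2: N18 in closed form at θ, N22 ⟸ N18 STRIP); at `Rg := Node00.unityNondeg₁₃H N`, `N = 2` THE ITEM is
leaf A §4 of this.  Every displayed hypothesis 0∕1 today. [bookkeeping] -/
theorem spine_rec13CCoPHOn_at_readingAdm₁₃CoPH_of_c2Bg_family (Rg : (F : T4Family) → Stage13HParams F N → Prop) {b aS : ℝ} (hb : 0 < b) (haS : 0 < aS) {c35 : ℝ} (hc35 : 0 < c35) (α β : Fin 4) (p : ℝ)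
    (h14 : ∀ (F : T4Family) (θ : Stage13HParams F N), θ.Provisos₁₃CoPH F N → Rg F θ → θ.Admissible F N → ∀ (g₀ : ℕ → ℝ) (os : List (ULoop F)),
      N14At (ne1 F θ g₀ os))
    (h16 : ∀ (F : T4Family), (∃ θ : Stage13HParams F N, θ.Provisos₁₃CoPH F N ∧ Rg F θ ∧ θ.Admissible F N) →
      InEndRegime (ne3OfRecord₁₁ F (ne3ConstLayerOfRecord₁₁ F N (ℓ₃ F))) ∧ LeafSlotAT (ne3OfRecord₁₁ F (ne3ConstLayerOfRecord₁₁ F N (ℓ₃ F))))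
    (h18 : ∀ (F : T4Family) (θ : Stage13HParams F N), θ.Provisos₁₃CoPH F N → Rg F θ → θ.Admissible F N → ∀ (k : ℕ) (b : ℝ), 0 < b → b ≤ θ.γ →
      ∀ g ∈ Window θ.γ,
        ∀ (U : {U : GaugeField (F.P (k + 1)) 0 (Node00.SU N) //
            ∀ (j : ℕ) (Y : (domSys (F.P (k + 1)) θ.τ9.M j).Dom), ofBackgroundC (ιSU N) U ∈ sp F θ (k + 1) j Y})
          (X : Node00.W1.Dom (F.P k) θ.τ9.M),
        |(functionalC (S F θ k) g (ofBackgroundC (ιSU N) (T₀ F θ k U.1)) X).re -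
            (functionalC (S F θ (k + 1)) (prependCoupling b g) (ofBackgroundC (ιSU N) U.1) (pairOfRecord F θ.τ9.M k X)).re| ≤
          (li F θ).C₅ * (li F θ).θ₅ ^ X.1 * Real.exp (-((li F θ).κ * (domSys (F.P k) θ.τ9.M X.1).dj X.2)))
    -- N22 ⟸ N18 (dag-n22-e module 8a″, STRIP currency on the reading's OWN table, NO readings clause): (J), twelve numerals, STRIP-(1.18) — verbatim
    (hjunk : ∀ (F : T4Family) (θ : Stage13HParams F N), θ.Provisos₁₃CoPH F N → Rg F θ → θ.Admissible F N →
      ∀ (k : ℕ) (X : Node00.W1.Dom (F.P k) θ.τ9.M), k < X.1 → ∀ (g : ℕ → ℝ) (φ : CPair (F.P k) (MatA N)), functionalC (S F θ k) g φ X = 0)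
    (hnum : ∀ (F : T4Family) (θ : Stage13HParams F N), θ.Provisos₁₃CoPH F N → Rg F θ → θ.Admissible F N →
      0 < (li F θ).C₀ ∧ 0 < (li F θ).θ₅ ∧ (li F θ).θ₅ < 1 ∧ 0 ≤ (li F θ).C₅ ∧ 2 * (li F θ).C₅ / (1 - (li F θ).θ₅) ≤ (li F θ).C₀ ∧ 0 < (li F θ).A ∧
        (li F θ).θ₅ ≤ (li F θ).μ ∧ (li F θ).C₀ ≤ 2 * (li F θ).A ∧ 0 < (li F θ).r ∧ 0 < (li F θ).s ∧ (li F θ).s < 1 ∧ 1 ≤ (li F θ).μ)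
    (hstrip : ∀ (F : T4Family) (θ : Stage13HParams F N), θ.Provisos₁₃CoPH F N → Rg F θ → θ.Admissible F N → ∀ (k : ℕ),
      ∀ (j : ℕ) (g : ℕ → ℝ), g ∈ Window θ.γ → ∀ (i : ℕ) (Y : (domSys (F.P k) θ.τ9.M j).Dom) (ψ : CPair (F.P k) (MatA N)), ψ ∈ sp F θ k j Y →
        ∃ (Ec : ℂ → ℂ) (O : Set ℂ), IsOpen O ∧ (∀ t ∈ Ioc (0 : ℝ) θ.γ, closedBall (t : ℂ) (li F θ).r ⊆ O) ∧ DifferentiableOn ℂ Ec O ∧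
          (∀ z ∈ O, ‖Ec z‖ ≤ (li F θ).A * Real.exp (-((li F θ).κ * torusTreeLen Y.1))) ∧
          (∀ t ∈ Ioc (0 : ℝ) θ.γ, Ec t = termC (S F θ k) j Y (Function.update g i t) ψ))
    (hD4 : ∀ (F : T4Family) (θ : Stage13HParams F N) (hP : θ.Provisos₁₃CoPH F N), Rg F θ → θ.Admissible F N → ∀ k : ℕ,
      ReadOutAt (datumOfRecord₁₃CoPH F N θ hP) (u3OfRecord₁₃ θ.toStage13Params
        ((ReadingData.ofRecordAdm F θ.τ9.M N (S F θ) (sp F θ) (gauge F θ) (hg F θ) (T₀ F θ) (hT₀ F θ) (li F θ)).u3Objects θ.γ) k))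
    (h20 : S_N20 (SRec₁₃CoPHOn cr Rg)) (h21 : S_N21 (SRec₁₃CoPHOn cr Rg))
    (hx : ∀ (F : T4Family) (θ : Stage13HParams F N) (hP : θ.Provisos₁₃CoPH F N), Rg F θ → θ.Admissible F N →
      B16.EndStatementBPrinted (datumOfRecord₁₃CoPH F N θ hP).C → DagBinding.EndpointExistence (datumOfRecord₁₃CoPH F N θ hP).C.toB12 →
        ForSmallCouplings (datumOfRecord₁₃CoPH F N θ hP) fun g₀ => ∀ os : List (ULoop F),
          0 < (cr F θ hP g₀ os).l₀ ∧ 0 < (cr F θ hP g₀ os).vol ∧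
          (∀ (K : ℕ) (t : ℝ), |t| ≤ (cr F θ hP g₀ os).l₀ →
            T4GenFunBounds.schemeZ ((datumOfRecord₁₃CoPH F N θ hP).scheme g₀) os ((cr F θ hP g₀ os).K₀ + K) t =
              ∑ τ ∈ (cr F θ hP g₀ os).T K, (cr F θ hP g₀ os).A K t τ) ∧
          (∀ (K : ℕ) (t : ℝ), |t| ≤ (cr F θ hP g₀ os).l₀ →
            T4GenFunBounds.schemeZ ((datumOfRecord₁₃CoPH F N θ hP).scheme g₀) os ((cr F θ hP g₀ os).K₀ + K + 1) t =
              ∑ τ ∈ (cr F θ hP g₀ os).T K, (cr F θ hP g₀ os).B K t τ))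
    (h19 : ∀ (F : T4Family) (θ : Stage13HParams F N) (hP : θ.Provisos₁₃CoPH F N), Rg F θ → θ.Admissible F N → ∀ (g₀ : ℕ → ℝ) (os : List (ULoop F)),
      (∀ k : ℕ, RatesAt (datumOfRecord₁₃CoPH F N θ hP) (rateCarriersOfRecord₁₃CoPH (readingOfRecord₁₃CoPH
        (fun F θ => ReadingData.ofRecordAdm F θ.τ9.M N (S F θ) (sp F θ) (gauge F θ) (hg F θ) (T₀ F θ) (hT₀ F θ) (li F θ)) ℓ₃ ne2 ne1) F θ hP g₀ os k)) →
        letI := (cr F θ hP g₀ os).dec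
        ∃ δ : ℕ → ℝ, NE7.Core (cr F θ hP g₀ os).l₀ (cr F θ hP g₀ os).vol (cr F θ hP g₀ os).T (cr F θ hP g₀ os).Bad
          (fun K t τ => (cr F θ hP g₀ os).A K t τ - (cr F θ hP g₀ os).shA K t τ) (fun K t τ => (cr F θ hP g₀ os).B K t τ - (cr F θ hP g₀ os).shB K t τ) δ ∧
          Summable δ)
    (hne2 : ∀ (F : T4Family) (θ : Stage13HParams F N), θ.Provisos₁₃CoPH F N → θ.Admissible F N → ∀ (g₀ : ℕ → ℝ) (os : List (ULoop F)) (k : ℕ),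
      ne2 F θ g₀ os k = haveI := neZero_blockFactor F; c2BgObjects 3 F.hL b aS α β c35 p) :
    Spine (N := N) fun F D w => Node00.IsRecordOfRecord₁₃CCoPHOn F N Rg D w :=
  have h18' : S_N18 (RRec₁₃CoPHOn (readingOfRecord₁₃CoPH
      (fun F θ => ReadingData.ofRecordAdm F θ.τ9.M N (S F θ) (sp F θ) (gauge F θ) (hg F θ) (T₀ F θ) (hT₀ F θ) (li F θ)) ℓ₃ ne2 ne1) Rg) :=
    (s_N18_readingOfRecord₁₃CoPHOn_iff _ ℓ₃ ne2 ne1 Rg).mpr fun F θ hP hRg hθ k =>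
      (n18At_u3OfRecord₁₃_readingAdm_iff θ.toStage13Params k (S F θ) (sp F θ) (gauge F θ) (hg F θ) (T₀ F θ) (hT₀ F θ) (li F θ)).mpr (h18 F θ hP hRg hθ k)
  spine_rec13CCoPHOn_at_readingOfRecord₁₃CoPH cr _ ℓ₃ ne2 ne1 Rg
    ((s_N14_rRec₁₃CoPHOn_iff _ Rg).mpr fun F θ hP hRg hθ g₀ os => h14 F θ hP hRg hθ g₀ os)
    (s_N15_readingOfRecord₁₃CoPHOn_of_c2Bg_family _ ℓ₃ ne2 ne1 hb haS hc35 α β p hne2 Rg)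
    (s_N16_rRec₁₃CoPHOn_ofRecord_of_leafSlotAT (readingOfRecord₁₃CoPH _ ℓ₃ ne2 ne1) Rg ℓ₃ (fun _ _ _ _ _ _ => rfl) h16)
    h18' (s_N22_readingOfRecord₁₃CoPHOn_ofRecordAdm_of_s_N18_stripBound S sp gauge hg T₀ hT₀ li ℓ₃ ne2 ne1 Rg h18' hjunk hnum hstrip)
    ((s_D4_rRec₁₃CoPHOn_iff _ Rg).mpr fun F θ hP hRg hθ _ _ k => hD4 F θ hP hRg hθ k) h20 h21 hx h19

end Regime

end Summit.QuantumFields.YangMills.Theorems.BalabanUVNodesN27SpineRecord
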